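import Summits.KontsevichZagierPeriods.KontsevichZagierPeriods.Theorems.HurwitzMicroSectorsHurwitzSectorComplementStubLadderEngineHalfAngle
import Summits.KontsevichZagierPeriods.KontsevichZagierPeriods.Theorems.HurwitzMicroSectorsHurwitzSectorComplementStubClausenCells

/-!
# `HurwitzSectorComplement` (stmt-KontsevichZagierPeriods-14341, route HurwitzMicroSectors),
# line `chebyshev-level-deformation`: the Catalan–Clausen junction

`[ (0,1)², 1/(1+x²y²) ] − [p₊] + [p₋] ∈ KZ.relations`: Catalan's box representation of
`G = Σ (−1)ⁿ/(2n+1)²` is congruent, modulo the Kontsevich–Zagier moves, to the difference of the two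
`ℚ`-rational cells `p₊ = [{0<v<1, 4v²/(1+v²) < u < 1}, 1/((1+v²)u)]`,
`p₋ = [{0<v<1, 1 < u < 4v²/(1+v²)}, 1/((1+v²)u)]` of the unfolded Clausen arc
`−∫₀^{π/2} log(2 sin(φ/2)) dφ` (`v = tan(φ/2)`) — the arc shape of route K2SymbolChains'
`ClausenPiVanishes`. This is `CatalanClausenJunction` of the crux ideation
(`Cruxes/HurwitzSectorComplement/SketchIdeator2.lean` §2, statement verbatim up to unfolding `box 2`),
the junction stub of line `chebyshev-level-deformation`: the U-step of the ladder engine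
(`stub_ladderEngine_halfAngle`, box dimension 2, no parameters, cap `V = 1`: the kernel
`U(1;s) = 2/((1−s)²+(1+s)²) = 1/(1+s²)`) turns Catalan's box into the logarithmic bottom
`[(x,v) ∈ (0,1)², g(v)T(v;x)]`, and `stub_clausenCells` cuts that into the two Clausen cells.
Reference: M. Kontsevich, D. Zagier, *Periods* (2001), §1.2 (rules (1)–(3)).
-/

noncomputable section

open Set MeasureTheory
open scoped BigOperators
open Literature.NumberTheory.Transcendental

namespace Summit.KontsevichZagierPeriods.Theorems.HurwitzMicroSectorsHurwitzSectorComplement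

namespace CatalanClausen

/-- **The U-step of the ladder at box dimension 2, no parameters, cap `V = 1`**, read back from
`stub_ladderEngine_halfAngle` with the kernels instantiated (numerals normalised by definitional
unfolding). [cite: KontsevichZagier2001, §1.2 rule (3)] -/
theorem uStep_two (r : KZ.IntegralRep 2)
    (hd : r.domain = {z : Fin 2 → ℝ | (∀ i : Fin 2, z i ∈ Set.Ioo (0:ℝ) 1) ∧
      StrictAnti (Fin.cons (1:ℝ) (fun i : Fin 0 => z (Fin.natAdd 2 i)) : Fin 1 → ℝ) ∧
      (0:ℝ) < (Fin.cons (1:ℝ) (fun i : Fin 0 => z (Fin.natAdd 2 i)) : Fin 1 → ℝ) (Fin.last 0)})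
    (hf : Set.EqOn r.integrand (fun z => (∏ i : Fin 0, 2 / (1 + z (Fin.natAdd 2 i) ^ 2)) *
      (2 * ((Fin.cons (1:ℝ) (fun i : Fin 0 => z (Fin.natAdd 2 i)) : Fin 1 → ℝ) (Fin.last 0)) /
        ((1 - ∏ i : Fin 2, z i) ^ 2 +
          ((Fin.cons (1:ℝ) (fun i : Fin 0 => z (Fin.natAdd 2 i)) : Fin 1 → ℝ) (Fin.last 0)) ^ 2 *
            (1 + ∏ i : Fin 2, z i) ^ 2))) r.domain) :
    ∃ (r₂ : KZ.IntegralRep 2),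
      r₂.domain = {z : Fin 2 → ℝ | (∀ i : Fin 1, z (Fin.castAdd 1 i) ∈ Set.Ioo (0:ℝ) 1) ∧
        StrictAnti (Fin.cons (1:ℝ) (fun i : Fin 1 => z (Fin.natAdd 1 i)) : Fin 2 → ℝ) ∧
        (0:ℝ) < (Fin.cons (1:ℝ) (fun i : Fin 1 => z (Fin.natAdd 1 i)) : Fin 2 → ℝ) (Fin.last 1)} ∧
      Set.EqOn r₂.integrand (fun z => (∏ i : Fin 1, 2 / (1 + z (Fin.natAdd 1 i) ^ 2)) *
        (((1 - ((Fin.cons (1:ℝ) (fun i : Fin 1 => z (Fin.natAdd 1 i)) : Fin 2 → ℝ) (Fin.last 1)) ^ 2) -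
            (1 + ((Fin.cons (1:ℝ) (fun i : Fin 1 => z (Fin.natAdd 1 i)) : Fin 2 → ℝ) (Fin.last 1)) ^ 2) *
              ∏ i : Fin 1, z (Fin.castAdd 1 i)) /
          ((1 - ∏ i : Fin 1, z (Fin.castAdd 1 i)) ^ 2 +
            ((Fin.cons (1:ℝ) (fun i : Fin 1 => z (Fin.natAdd 1 i)) : Fin 2 → ℝ) (Fin.last 1)) ^ 2 *
              (1 + ∏ i : Fin 1, z (Fin.castAdd 1 i)) ^ 2))) r₂.domain ∧
      KZ.of r - KZ.of r₂ ∈ KZ.relations := by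
  have h := stub_ladderEngine_halfAngle (fun v => 2 / (1 + v ^ 2))
    (fun v s => ((1 - v ^ 2) - (1 + v ^ 2) * s) / ((1 - s) ^ 2 + v ^ 2 * (1 + s) ^ 2))
    (fun v s => 2 * v / ((1 - s) ^ 2 + v ^ 2 * (1 + s) ^ 2))
    (fun n j V => {z : Fin (n + j) → ℝ | (∀ i : Fin n, z (Fin.castAdd j i) ∈ Set.Ioo (0:ℝ) 1) ∧
      StrictAnti (Fin.cons V (fun i : Fin j => z (Fin.natAdd n i)) : Fin (j + 1) → ℝ) ∧
      0 < (Fin.cons V (fun i : Fin j => z (Fin.natAdd n i)) : Fin (j + 1) → ℝ) (Fin.last j)})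
    (fun n j z => ∏ i : Fin j, 2 / (1 + z (Fin.natAdd n i) ^ 2))
    (fun n j z => ∏ i : Fin n, z (Fin.castAdd j i))
    (fun n j V z => (Fin.cons V (fun i : Fin j => z (Fin.natAdd n i)) : Fin (j + 1) → ℝ) (Fin.last j))
    (fun _ => rfl) (fun _ _ => rfl) (fun _ _ => rfl) (fun _ _ _ _ => Iff.rfl) (fun _ _ _ => rfl)
    (fun _ _ _ => rfl) (fun _ _ _ _ => rfl) 0 0 1 isAlgebraic_one one_pos
  exact h.2 r hd hf

end CatalanClausen

open CatalanClausen in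
/-- **The Catalan–Clausen junction.** Catalan's box representation `[(0,1)², 1/(1+x²y²)]` against the
two cells of the unfolded Clausen arc: `[box², 1/(1+(xy)²)] − [p₊] + [p₋] ∈ KZ.relations`
(`CatalanClausenJunction` of SketchIdeator2 §2, with `box 2` unfolded). Chain: the U-step of the ladder
at cap `V = 1` (`U(1;s) = 1/(1+s²)`), then the Clausen cells. [cite: KontsevichZagier2001, §1.2 rules (1)–(3)] -/
theorem catalanClausenJunction : ∀ (rG pPlus pMinus : KZ.IntegralRep 2),
    rG.domain = {x | ∀ i, x i ∈ Set.Ioo (0:ℝ) 1} →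
    Set.EqOn rG.integrand (fun x => 1 / (1 + (x 0 * x 1) ^ 2)) rG.domain →
    pPlus.domain = {v | 0 < v 0 ∧ v 0 < 1 ∧ 4 * v 0 ^ 2 / (1 + v 0 ^ 2) < v 1 ∧ v 1 < 1} →
    Set.EqOn pPlus.integrand (fun v => 1 / ((1 + v 0 ^ 2) * v 1)) pPlus.domain →
    pMinus.domain = {v | 0 < v 0 ∧ v 0 < 1 ∧ 1 < v 1 ∧ v 1 < 4 * v 0 ^ 2 / (1 + v 0 ^ 2)} →
    Set.EqOn pMinus.integrand (fun v => 1 / ((1 + v 0 ^ 2) * v 1)) pMinus.domain →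
    KZ.of rG - KZ.of pPlus + KZ.of pMinus ∈ KZ.relations := by
  intro rG pPlus pMinus hGd hGf hPd hPf hMd hMf
  have hcons0 : ∀ z : Fin 2 → ℝ,
      (Fin.cons (1:ℝ) (fun i : Fin 0 => z (Fin.natAdd 2 i)) : Fin 1 → ℝ) (Fin.last 0) = 1 :=
    fun _ => rfl
  -- Catalan's box is the U-kernel stage representation at cap 1
  have hd : rG.domain = {z : Fin 2 → ℝ | (∀ i : Fin 2, z i ∈ Set.Ioo (0:ℝ) 1) ∧
      StrictAnti (Fin.cons (1:ℝ) (fun i : Fin 0 => z (Fin.natAdd 2 i)) : Fin 1 → ℝ) ∧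
      (0:ℝ) < (Fin.cons (1:ℝ) (fun i : Fin 0 => z (Fin.natAdd 2 i)) : Fin 1 → ℝ) (Fin.last 0)} := by
    rw [hGd]
    ext z
    simp only [Set.mem_setOf_eq, hcons0, zero_lt_one, and_true]
    haveI : Subsingleton (Fin (0 + 1)) := Fin.subsingleton_iff_le_one.mpr (by norm_num)
    exact ⟨fun hz => ⟨hz, Subsingleton.strictAnti _⟩, fun hz => hz.1⟩
  have hf : Set.EqOn rG.integrand (fun z => (∏ i : Fin 0, 2 / (1 + z (Fin.natAdd 2 i) ^ 2)) *
      (2 * ((Fin.cons (1:ℝ) (fun i : Fin 0 => z (Fin.natAdd 2 i)) : Fin 1 → ℝ) (Fin.last 0)) /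
        ((1 - ∏ i : Fin 2, z i) ^ 2 +
          ((Fin.cons (1:ℝ) (fun i : Fin 0 => z (Fin.natAdd 2 i)) : Fin 1 → ℝ) (Fin.last 0)) ^ 2 *
            (1 + ∏ i : Fin 2, z i) ^ 2))) rG.domain := by
    intro z hz
    rw [hGf hz]
    simp only [hcons0, Finset.univ_eq_empty, Finset.prod_empty, one_mul, one_pow, Fin.prod_univ_two]
    have h1 : (1 - z 0 * z 1) ^ 2 + (1 + z 0 * z 1) ^ 2 = 2 * (1 + (z 0 * z 1) ^ 2) := by ring
    rw [h1]
    have h2 : (0:ℝ) < 1 + (z 0 * z 1) ^ 2 := by positivity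
    field_simp
  obtain ⟨q, hqd, hqf, hrel⟩ := uStep_two rG hd hf
  -- the logarithmic bottom `q` has the shape required by the Clausen cells
  have hlast : ∀ y : Fin 2 → ℝ,
      (Fin.cons (1:ℝ) (fun i : Fin 1 => y (Fin.natAdd 1 i)) : Fin 2 → ℝ) (Fin.last 1) = y 1 := by
    intro y
    show (Fin.cons (1:ℝ) (fun i : Fin 1 => y (Fin.natAdd 1 i)) : Fin 2 → ℝ) (Fin.succ 0) = y 1
    rw [Fin.cons_succ]
    rfl
  have hzero : ∀ y : Fin 2 → ℝ,
      (Fin.cons (1:ℝ) (fun i : Fin 1 => y (Fin.natAdd 1 i)) : Fin 2 → ℝ) 0 = 1 := fun _ => rfl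
  have hP : ∀ y : Fin 2 → ℝ, (∏ i : Fin 1, y (Fin.castAdd 1 i)) = y 0 := by
    intro y
    rw [Fin.prod_univ_one]
    rfl
  have hΩ : ∀ y : Fin 2 → ℝ, (∏ i : Fin 1, 2 / (1 + y (Fin.natAdd 1 i) ^ 2)) = 2 / (1 + y 1 ^ 2) := by
    intro y
    rw [Fin.prod_univ_one]
    rfl
  have hanti : ∀ y : Fin 2 → ℝ,
      StrictAnti (Fin.cons (1:ℝ) (fun i : Fin 1 => y (Fin.natAdd 1 i)) : Fin 2 → ℝ) ↔ y 1 < 1 := by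
    intro y
    rw [Fin.strictAnti_iff_succ_lt]
    constructor
    · intro h
      have := h 0
      rw [Fin.cons_succ] at this
      simpa [hzero] using this
    · intro h i
      have hi : i = 0 := Subsingleton.elim _ _
      subst hi
      rw [Fin.cons_succ]
      simpa [hzero] using h
  have hqd' : q.domain = {y : Fin 2 → ℝ | y 0 ∈ Set.Ioo (0:ℝ) 1 ∧ y 1 ∈ Set.Ioo (0:ℝ) 1} := by
    rw [hqd]
    ext y
    simp only [Set.mem_setOf_eq, Set.mem_Ioo, hlast, hanti, Fin.forall_fin_one]
    constructor
    · rintro ⟨hb, h1, h0⟩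
      exact ⟨hb, h0, h1⟩
    · rintro ⟨h0, h1, h2⟩
      exact ⟨h0, h2, h1⟩
  have hqf' : Set.EqOn q.integrand (fun y => 2 / (1 + y 1 ^ 2) *
      (((1 - y 1 ^ 2) - (1 + y 1 ^ 2) * y 0) / ((1 - y 0) ^ 2 + y 1 ^ 2 * (1 + y 0) ^ 2))) q.domain := by
    intro y hy
    rw [hqf hy]
    simp only [hlast, hP, hΩ]
  have hcells := stub_clausenCells q pPlus pMinus hqd' hqf' hPd hPf hMd hMf
  -- compose
  have : KZ.of rG - KZ.of pPlus + KZ.of pMinus = (KZ.of rG - KZ.of q) + (KZ.of q - KZ.of pPlus + KZ.of pMinus) := by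
    abel
  rw [this]
  exact KZ.relations.add_mem hrel hcells

end Summit.KontsevichZagierPeriods.Theorems.HurwitzMicroSectorsHurwitzSectorComplement

end
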